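import Summits.Ventures.Crystal3D.Theorems.StickyWulffConstantTextureLiminfTexShadowVocabulary
import HarnessLib

/-!
# TB-D assembly, part 8: the texture's WALL DATA `(c, m)` chosen from the frames by the three-regime case split
# (lane T, crux `TextureLiminfV5`, stmt-Ventures-23912; design memo TB-D-0 §8 (F3)–(F5), §9 `PieceData.hc/hlaw₀/hlaw₁`)

HONEST FRAMING. Venture `Summits/Ventures/Crystal3D` (cell `crystal3d-full`), route `route-Ventures-StickyWulffConstant`, helper `--supports` the
law-v5 crux `TextureLiminfV5` (stmt-Ventures-23912).  Two small DEFINITIONS + their case lemmas (census-free, standard axioms); F-C1 not moved.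

For a family of grain frames `A : ι → (E3 ≃ₗᵢ[ℝ] E3)` the texture construction takes the CHEAPEST wall data the law `IsTexture (13/25) (1/2)`
allows: `lawC A ℓ ℓ' = 0` if the two frame lattices are equal, `= 1/2` if they are co-axial and distinct, `= 13/25` otherwise; `lawM A ℓ ℓ' =` a
shared axis in the co-axial-distinct case, `0` otherwise.  Lemmas: the three law clauses (`lawC_nonneg`, `law_not_coAx`, `law_coAx_ne`) in the
shape of `PieceData.hc/hlaw₀/hlaw₁`, and the values in each regime (`lawC_of_eq`, `lawC_of_coAx_ne`, `sharedAxis_lawM`, `lawC_of_not_coAx`,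
`lawM_of_not_coAx`, `lawC_le`).
-/

noncomputable section

namespace Summit.Ventures.Crystal3D.Cruxes.TextureLiminf.TexShadow

open Summit.Ventures.Crystal3D
open Literature.MathematicalPhysics.StatisticalMechanics (barlowStacking constHagg isHaggSeq_const)

open scoped Classical in
/-- the texture's wall CHARGE between grains with frames `A ℓ`, `A ℓ'`: `0` (equal lattices) / `1/2` (co-axial, distinct) / `13/25` (generic). -/
def lawC {ι : Type*} (A : ι → (E3 ≃ₗᵢ[ℝ] E3)) (ℓ ℓ' : ι) : ℝ :=
  if A ℓ '' fccRef = A ℓ' '' fccRef then 0 else if CoAx (A ℓ) (A ℓ') then 1 / 2 else 13 / 25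

open scoped Classical in
/-- the texture's wall AXIS between grains with frames `A ℓ`, `A ℓ'`: a shared axis in the co-axial-distinct case, `0` otherwise. -/
def lawM {ι : Type*} (A : ι → (E3 ≃ₗᵢ[ℝ] E3)) (ℓ ℓ' : ι) : E3 :=
  if h : CoAx (A ℓ) (A ℓ') ∧ A ℓ '' fccRef ≠ A ℓ' '' fccRef then Classical.choose h.1 else 0

variable {ι : Type*} (A : ι → (E3 ≃ₗᵢ[ℝ] E3))

/-- `lawC ≥ 0`. -/
theorem lawC_nonneg (ℓ ℓ' : ι) : 0 ≤ lawC A ℓ ℓ' := by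
  unfold lawC; split_ifs <;> norm_num

/-- `lawC ≤ 13/25`. -/
theorem lawC_le (ℓ ℓ' : ι) : lawC A ℓ ℓ' ≤ 13 / 25 := by
  unfold lawC; split_ifs <;> norm_num

/-- Equal lattices: charge `0`. -/
theorem lawC_of_eq {ℓ ℓ' : ι} (h : A ℓ '' fccRef = A ℓ' '' fccRef) : lawC A ℓ ℓ' = 0 := by
  unfold lawC; rw [if_pos h]

/-- Co-axial, distinct lattices: charge `1/2`. -/
theorem lawC_of_coAx_ne {ℓ ℓ' : ι} (hco : CoAx (A ℓ) (A ℓ')) (hne : A ℓ '' fccRef ≠ A ℓ' '' fccRef) : lawC A ℓ ℓ' = 1 / 2 := by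
  unfold lawC; rw [if_neg hne, if_pos hco]

/-- Co-axial, distinct lattices: `lawM` is a shared axis. -/
theorem sharedAxis_lawM {ℓ ℓ' : ι} (hco : CoAx (A ℓ) (A ℓ')) (hne : A ℓ '' fccRef ≠ A ℓ' '' fccRef) :
    SharedAxis (lawM A ℓ ℓ') (A ℓ) (A ℓ') := by
  unfold lawM
  rw [dif_pos ⟨hco, hne⟩]
  exact Classical.choose_spec hco

/-- A frame's lattice lies in the frame's own fcc stacking (zero origin, constant Hägg word). -/
theorem image_fccRef_subset_self_stacking (F : E3 ≃ₗᵢ[ℝ] E3) :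
    F '' fccRef ⊆ (fun p => F p + (0 : E3)) '' barlowStacking 1 (Real.sqrt (2 / 3)) constHagg := by
  rintro _ ⟨p, hp, rfl⟩
  exact ⟨p, hp, by simp⟩

/-- **Equal lattices are co-axial** (the common frame is the frame itself). -/
theorem coAx_of_image_eq {F G : E3 ≃ₗᵢ[ℝ] E3} (h : F '' fccRef = G '' fccRef) : CoAx F G :=
  ⟨F e₃, F, 0, 0, constHagg, constHagg, isHaggSeq_const, isHaggSeq_const, rfl,
    image_fccRef_subset_self_stacking F, h ▸ image_fccRef_subset_self_stacking F⟩

/-- Not co-axial: charge `13/25`. -/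
theorem lawC_of_not_coAx {ℓ ℓ' : ι} (h : ¬ CoAx (A ℓ) (A ℓ')) : lawC A ℓ ℓ' = 13 / 25 := by
  have hne : A ℓ '' fccRef ≠ A ℓ' '' fccRef := fun heq => h (coAx_of_image_eq heq)
  unfold lawC; rw [if_neg hne, if_neg h]

/-- Not co-axial: axis `0`. -/
theorem lawM_of_not_coAx {ℓ ℓ' : ι} (h : ¬ CoAx (A ℓ) (A ℓ')) : lawM A ℓ ℓ' = 0 := by
  unfold lawM; rw [dif_neg (fun h' => h h'.1)]

/-- **The law clauses** of `IsTexture (13/25) (1/2)` for the wall data `(lawC A, lawM A)`. -/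
theorem law_not_coAx {ℓ ℓ' : ι} (h : ¬ CoAx (A ℓ) (A ℓ')) : lawM A ℓ ℓ' = 0 ∧ (13 / 25 : ℝ) ≤ lawC A ℓ ℓ' :=
  ⟨lawM_of_not_coAx A h, (lawC_of_not_coAx A h).ge⟩

/-- The co-axial clause. -/
theorem law_coAx_ne {ℓ ℓ' : ι} (hco : CoAx (A ℓ) (A ℓ')) (hne : A ℓ '' fccRef ≠ A ℓ' '' fccRef) :
    SharedAxis (lawM A ℓ ℓ') (A ℓ) (A ℓ') ∧ (1 / 2 : ℝ) ≤ lawC A ℓ ℓ' :=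
  ⟨sharedAxis_lawM A hco hne, (lawC_of_coAx_ne A hco hne).ge⟩

end Summit.Ventures.Crystal3D.Cruxes.TextureLiminf.TexShadow

end
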